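import Literature.AnabelianGeometry.SemiGraphs.TemperedCompactInVerticialOfOneChart
import Literature.AnabelianGeometry.SemiGraphs.TemperedLevelDictionary
import HarnessLib

/-!
# [SemiAnbd] Theorem 3.7 (iii) from one per-level branch dictionary

Mochizuki, *Semi-graphs of anabelioids*, Publ. RIMS **42** (2006), §3, Theorem 3.7 (iii), manuscript
pp. 40–41 [cite: MochizukiSemiAnbd2006, Thm 3.7(iii) pp.40-41].  The last glue of the cell's rung 3:
seat abc-iut-L3-t11's `LevelDictionary` (the finite-level tower with a compact overgroup and four
single-level obligations (DV), (DB), (DI), (DN) — Remark 2.2.1 / Definition 2.2 (i) at one level) ⇒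
`FiniteLevelData` (its `toFiniteLevelData`) ⇒ both conjuncts of `CompactInVerticial` at every chart
(`TemperedCompactInVerticialOfOneChart.lean`).  Proof-only; nothing here takes a side on [IUTchIII]
Cor. 3.12.
-/

namespace Literature.AnabelianGeometry.SemiGraphs

namespace ProfiniteSemiGraph

namespace FiniteLevelData

open Topology

universe v u

/-- **Theorem 3.7 (iii) from ONE per-level branch dictionary** (the producer's deliverable in its
final form, cell rulings ν2/φ2): a `LevelDictionary 𝒢 c₀` over one chart `c₀` satisfying the four
single-level obligations (DV), (DB), (DI), (DN) yields both conjuncts of `CompactInVerticial` at EVERY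
chart `c` of `𝒢` and every compact `C` (glue `toFiniteLevelData`, chart transport,
`FiniteLevelData.compactInVerticial`, Thm. 3.7 (i)/(ii) by name). [cite: MochizukiSemiAnbd2006, Thm 3.7(iii) pp.40-41] -/
theorem compactInVerticial_of_levelDictionary {𝒢 : ProfiniteSemiGraph.{u}} {c₀ : TemperedPiChart 𝒢}
    (X : LevelDictionary.{v} 𝒢 c₀) (h₁ : X.DV) (h₂ : X.DB) (h₃ : X.DI) (h₄ : X.DN)
    (h𝒢 : 𝒢.Thm37Hypotheses) (c : TemperedPiChart 𝒢) (C : Subgroup c.G)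
    (hC : IsCompact (C : Set c.G)) :
    (∃ (v : 𝒢.graph.Vertex) (H : Subgroup c.G), H ∈ verticialSubgroups c v ∧ C ≤ H) ∧
      (C ≠ ⊥ → ∀ (v₁ v₂ : 𝒢.graph.Vertex) (H₁ H₂ : Subgroup c.G), H₁ ∈ verticialSubgroups c v₁ →
        H₂ ∈ verticialSubgroups c v₂ → H₁ ≠ H₂ → C ≤ H₁ → C ≤ H₂ →
          (∀ (v₃ : 𝒢.graph.Vertex) (H₃ : Subgroup c.G), H₃ ∈ verticialSubgroups c v₃ → C ≤ H₃ →
              H₃ = H₁ ∨ H₃ = H₂) ∧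
          ∃ (e : 𝒢.graph.Edge) (L : Subgroup c.G), 𝒢.graph.IsClosedEdge e ∧
            L ∈ edgeLikeSubgroups c e ∧ C ≤ L) := by
  obtain ⟨D⟩ := FiniteLevelData.nonempty_of_nonempty ⟨X.toFiniteLevelData h₁ h₂ h₃ h₄⟩ c
  exact FiniteLevelData.compactInVerticial D verticialDistinct_holds h𝒢
    (fun v => (verticialInjective_holds 𝒢 h𝒢 c v).1) C hC

end FiniteLevelData

end ProfiniteSemiGraph

end Literature.AnabelianGeometry.SemiGraphs
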